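import Summits.CriticalPhenomena.PercolationContinuityZ3.Theorems.PercNearOneGluingNoHeavyLowerTailThreePartitionSaturation
import Summits.CriticalPhenomena.PercolationContinuityZ3.Theorems.PercNearOneGluingNoHeavyLowerTailSahiAbsorbedSaturation
import Summits.CriticalPhenomena.PercolationContinuityZ3.Theorems.PercNearOneGluingNoHeavyLowerTailSahiCombMasterFamily

/-!
# COMB-LEVEL SATURATION AT EVERY ORDER: (M⁺-(n+2)) on a finite cube is decided on the families co-generated by
# `(n+2)`-coloured antichains, given (M⁺-k) for `k ≤ n+1` on the same cube

Support file (cell `prim-sahi`, seat `prim-sahi-typer` gen 33; `--supports stmt-CriticalPhenomena-4575`).  Pure proofs, no definitions,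
no `sorry`, standard axioms.  Vocabulary: `SahiComb.CombPos` (tensor-Bernstein positivity, `…SahiCombPositivity`), Sahi's `E_n` under the
product weight `bernoulliWeight p` (`Literature.Combinatorics.Sahi2008`), the head block expansion and sub-family cycle sums of lane
prim-masterthm-p3 (`SahiAbsorbed.sahiE_cons_eq_sum_powerset`, `ncs`, `cycleSum`), and the abstract saturation of `…ThreePartitionSaturation`
(`Saturation.le_of_colouring`, this generation).

THE MATHEMATICS.  The value-level saturation (`SahiAbsorbed.sahiPositive_of_colouring`, P3/typer gen 27) decides Sahi's `C_{n+2}(μ)` for ONE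
weight on the coloured-antichain families, the step being the sign law "adding to a member a maximal non-element lying outside another member does
not increase `E_{n+2}`", itself a consequence of `C_{≤ n+1}(μ)` through the head block expansion
`E_{n+1}(g, f) = Σ_{S ⊆ [n]} |S|!·E[g·Π_{j∈S} f_j]·ncs(f|_{[n]∖S})` (`ncs(A) = −E_{|A|}(f|_A)` in cycle form for `A ≠ ∅`): for a point-mass head
`g = 1_{{y}}` killed by the member `j₀` (`y ∉ U_{j₀}`) the blocks through `j₀` vanish and
  `−E_{n+1}(1_{{y}}, 1_U) = Σ_{S ∌ j₀} |S|! · μ(y)·Π_{j∈S} 1_{U_j}(y) · E_{|∁S|}(1_{U|∁S})`.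
Read for the product weights `μ_p`, `p ∈ [0,1]^ι`, ALL AT ONCE, every summand is COMB-POSITIVE as soon as the sub-families of `U` are:
`p ↦ μ_p(y)·Π 1_{U_j}(y)` is a moment (`SahiComb.combPos_ex`, multidegree `1`), `p ↦ E_k(μ_p; 1_{U|A})` is comb-positive of multidegree `k`
by (M⁺-k), and multidegrees add (`CombPos.mul_of_le`, `1 + |∁S| ≤ n+1`).  Hence:

* `combPos_cycleSum_subfamily` — (M⁺-k), `k ≤ n`, on the ground set `ι` makes every nonempty sub-family cycle sum comb-positive;
* **`combPos_neg_sahiE_cons_of_disjoint`** — the COMB SIGN⁻ LAW: for a head `1_W` disjoint from the member `U_{j₀}` and comb-positive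
  sub-families through `j₀`, `p ↦ −E_{n+1}(μ_p; 1_W, 1_U)` is comb-positive of multidegree `n+1`;
* `combPos_sahiE_cons_sub_insert`, **`combPos_sahiE_sub_update_insert`** — the comb sign-law STEP in every slot: given (M⁺-k) on `ι` for
  `k ≤ n+1`, adding to a member `F_i` of a family of `n+2` increasing families a point outside `F_i` and outside another member `F_j`
  changes `p ↦ E_{n+2}(μ_p; 1_F)` by a comb-NONPOSITIVE amount (`E(before) − E(after)` is comb-positive);
* **`combPos_sahiE_of_colouring`** — **(M⁺-(n+2)) ON `ι` IS DECIDED ON `(n+2)`-COLOURED ANTICHAINS**: given (M⁺-k) on `ι` for `1 ≤ k ≤ n+1`, if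
  `p ↦ E_{n+2}(μ_p; 1_{U_0}, …, 1_{U_{n+1}})` is comb-positive for every family `U_i = {S | ∀ T ∈ N, c T = i → ¬ S ⊆ T}` co-generated by an
  antichain `N ⊆ 2^ι` with a colouring `c : 2^ι → Fin (n+2)`, then it is comb-positive for EVERY family of `n+2` increasing families of `2^ι`.
  (Abstract saturation applied to the functional `F ↦ {G | E(F) − G comb-positive} ∈ Set _` ordered by inclusion: the comb order
  "`E(F') ≤ E(F)` iff `E(F) − E(F')` is comb-positive" is a preorder, which is all `Saturation.le_of_colouring` needs.)
Consumers: order `3` is `…SahiC3CombCubeFive` (there via the equivalent three-partition form); order `4` on five letters is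
`…SahiC4CombCubeFive` (typer gen 28's `colourCheck4_five` read at comb level).  Nothing here asserts (M⁺-k) for any `k ≥ 3`. [this work]
-/

namespace Summit.CriticalPhenomena.PercolationContinuityZ3.Theorems

open Finset Function Equiv
open Literature.Combinatorics.Sahi2008 Literature.Combinatorics.Sahi2008.CycleForm
open Literature.Probability.Percolation.DecisionTree (ind ind_of_mem ind_of_not_mem)

namespace SahiComb

open scoped Classical

variable {ι : Type} [Fintype ι]

/-! ### Sub-families -/

/-- **Sub-family cycle sums are comb-positive** under (M⁺-k), `k ≤ n`, on the ground set `ι`: for increasing `U_0, …, U_{n−1} ⊆ 2^ι` and a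
nonempty `A ⊆ [n]`, `p ↦ E(μ_p; 1_{U|A})` (cycle form, `cycleSum`) is comb-positive of multidegree `|A|`. [this work] -/
theorem combPos_cycleSum_subfamily {n : ℕ}
    (hM : ∀ k, 1 ≤ k → k ≤ n → ∀ V : Fin k → Finset (Set ι), (∀ j, IsUpperSet (V j : Set (Set ι))) →
      CombPos (fun _ : ι => k) (fun p => sahiE (bernoulliWeight p) k (fun j => setInd (V j))))
    (U : Fin n → Finset (Set ι)) (hU : ∀ j, IsUpperSet (U j : Set (Set ι))) (A : Finset (Fin n)) (hA : A.Nonempty) :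
    CombPos (fun _ : ι => A.card) (fun p => cycleSum (bernoulliWeight p) (fun j : {x // x ∈ A} => setInd (U j))) := by
  set e : Fin A.card ≃ {x // x ∈ A} := (A.orderIsoOfFin rfl).toEquiv with he
  have hk1 : 1 ≤ A.card := hA.card_pos
  have hkn : A.card ≤ n := by
    calc A.card ≤ (univ : Finset (Fin n)).card := card_le_card (subset_univ _)
      _ = n := by rw [card_univ, Fintype.card_fin]
  refine (hM _ hk1 hkn (fun i => U (e i)) (fun i => hU _)).congr fun p => ?_
  rw [← cycleSum_comp_equiv (bernoulliWeight p) e, ← sahiE_eq_cycleSum (bernoulliWeight p) hk1]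

/-! ### The comb SIGN⁻ law -/

/-- **THE COMB SIGN⁻ LAW.**  If the head event `W` is disjoint from the member `U_{j₀}` and every sub-family of `(1_{U_j})` through `j₀` has a
comb-positive cycle sum, then `p ↦ −E_{n+1}(μ_p; 1_W, 1_{U_0}, …, 1_{U_{n−1}})` is comb-positive of multidegree `n+1` — the head block expansion
`SahiAbsorbed.sahiE_cons_eq_sum_powerset` read coefficientwise: the blocks through `j₀` vanish, the others are
`|S|!·E_{μ_p}[1_W·Π_S 1_{U_j}]·E(μ_p; 1_{U|∁S})`, a moment (multidegree `1`) times a comb-positive sub-family functional (multidegree `|∁S| ≤ n`).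
[this work] -/
theorem combPos_neg_sahiE_cons_of_disjoint {n : ℕ} (W : Finset (Set ι)) (U : Fin n → Finset (Set ι)) (j₀ : Fin n)
    (hW : Disjoint W (U j₀))
    (hsub : ∀ A : Finset (Fin n), j₀ ∈ A →
      CombPos (fun _ : ι => A.card) (fun p => cycleSum (bernoulliWeight p) (fun j : {x // x ∈ A} => setInd (U j)))) :
    CombPos (fun _ : ι => n + 1)
      (fun p => - sahiE (bernoulliWeight p) (n + 1) (Fin.cons (setInd W) (fun j => setInd (U j)))) := by
  have key : ∀ p : ι → unitInterval,
      - sahiE (bernoulliWeight p) (n + 1) (Fin.cons (setInd W) (fun j => setInd (U j))) =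
        ∑ S ∈ (univ : Finset (Fin n)).powerset, (S.card.factorial : ℝ) *
          (ex (bernoulliWeight p) (fun x => setInd W x * ∏ j ∈ S, setInd (U j) x) *
            (- SahiAbsorbed.ncs (bernoulliWeight p) (fun j => setInd (U j)) (univ \ S))) := by
    intro p
    rw [SahiAbsorbed.sahiE_cons_eq_sum_powerset, ← sum_neg_distrib]
    refine sum_congr rfl fun S _ => ?_
    ring
  refine (CombPos.sum _ fun S _ => ?_).congr key
  by_cases hj : j₀ ∈ S
  · -- the head moment vanishes identically
    have h0 : ∀ p : ι → unitInterval, ex (bernoulliWeight p) (fun x => setInd W x * ∏ j ∈ S, setInd (U j) x) = 0 := by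
      intro p
      unfold ex
      refine sum_eq_zero fun x _ => ?_
      beta_reduce
      by_cases hx : x ∈ W
      · have hxU : x ∉ U j₀ := disjoint_left.1 hW hx
        rw [← mul_prod_erase S (fun j => setInd (U j) x) hj, setInd_apply (U j₀), if_neg hxU]
        ring
      · rw [setInd_apply W, if_neg hx]
        ring
    exact (CombPos.zero _).congr fun p => by rw [h0 p]; ring
  · have hA : (univ \ S).Nonempty := ⟨j₀, mem_sdiff.2 ⟨mem_univ _, hj⟩⟩
    have hmom : CombPos (fun _ : ι => 1)
        (fun p => ex (bernoulliWeight p) (fun x => setInd W x * ∏ j ∈ S, setInd (U j) x)) :=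
      combPos_ex fun ω => mul_nonneg (setInd_nonneg _ _) (prod_nonneg fun j _ => setInd_nonneg _ _)
    have hcyc : CombPos (fun _ : ι => (univ \ S).card)
        (fun p => - SahiAbsorbed.ncs (bernoulliWeight p) (fun j => setInd (U j)) (univ \ S)) := by
      refine (hsub (univ \ S) (mem_sdiff.2 ⟨mem_univ _, hj⟩)).congr fun p => ?_
      rw [SahiAbsorbed.ncs_eq_neg_cycleSum _ _ hA, neg_neg]
    have hdeg : ((fun _ : ι => 1) + fun _ : ι => (univ \ S).card) ≤ fun _ : ι => n + 1 := by
      intro e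
      simp only [Pi.add_apply]
      have : (univ \ S).card ≤ n := by
        calc (univ \ S).card ≤ (univ : Finset (Fin n)).card := card_le_card (subset_univ _)
          _ = n := by rw [card_univ, Fintype.card_fin]
      omega
    exact (hmom.mul_of_le hcyc hdeg).smul (Nat.cast_nonneg _)

/-- **The comb sign-law step at the head**: for `y ∉ W` lying outside the member `U_{j₀}`, with comb-positive sub-families through `j₀`,
`p ↦ E_{n+1}(μ_p; 1_W, 1_U) − E_{n+1}(μ_p; 1_{W ∪ {y}}, 1_U)` is comb-positive (linearity in the head + the SIGN⁻ law for the point-mass head).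
[this work] -/
theorem combPos_sahiE_cons_sub_insert {n : ℕ} (W : Finset (Set ι)) (U : Fin (n + 1) → Finset (Set ι)) {y : Set ι} (hyW : y ∉ W)
    (j₀ : Fin (n + 1)) (hy : y ∉ U j₀)
    (hsub : ∀ A : Finset (Fin (n + 1)), j₀ ∈ A →
      CombPos (fun _ : ι => A.card) (fun p => cycleSum (bernoulliWeight p) (fun j : {x // x ∈ A} => setInd (U j)))) :
    CombPos (fun _ : ι => n + 2)
      (fun p => sahiE (bernoulliWeight p) (n + 2) (Fin.cons (setInd W) (fun j => setInd (U j))) -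
        sahiE (bernoulliWeight p) (n + 2) (Fin.cons (setInd (insert y W)) (fun j => setInd (U j)))) := by
  refine (combPos_neg_sahiE_cons_of_disjoint (n := n + 1) {y} U j₀ (disjoint_singleton_left.2 hy) hsub).congr fun p => ?_
  rw [SahiAbsorbed.sahiE_cons_setInd_eq_sum_single _ (insert y W), SahiAbsorbed.sahiE_cons_setInd_eq_sum_single _ W,
    sum_insert hyW, SahiAbsorbed.sahiE_cons_setInd_eq_sum_single _ ({y} : Finset (Set ι)), sum_singleton]
  ring

/-- **The comb sign-law step in every slot.**  Given (M⁺-k) on the ground set `ι` for `1 ≤ k ≤ n+1`: for a family `F` of `n+2` increasing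
families of `2^ι`, a member `F i` and a point `y ∉ F i` lying outside another member `F j`, the difference
`p ↦ E_{n+2}(μ_p; 1_F) − E_{n+2}(μ_p; 1_{F with F i ↦ F i ∪ {y}})` is comb-positive of multidegree `n+2`. [this work] -/
theorem combPos_sahiE_sub_update_insert {n : ℕ}
    (hM : ∀ k, 1 ≤ k → k ≤ n + 1 → ∀ V : Fin k → Finset (Set ι), (∀ j, IsUpperSet (V j : Set (Set ι))) →
      CombPos (fun _ : ι => k) (fun p => sahiE (bernoulliWeight p) k (fun j => setInd (V j))))
    (F : Fin (n + 2) → Finset (Set ι)) (hF : ∀ j, IsUpperSet (F j : Set (Set ι))) (i j : Fin (n + 2)) (hij : i ≠ j)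
    (y : Set ι) (hyi : y ∉ F i) (hyj : y ∉ F j) :
    CombPos (fun _ : ι => n + 2)
      (fun p => sahiE (bernoulliWeight p) (n + 2) (fun l => setInd (F l)) -
        sahiE (bernoulliWeight p) (n + 2) (fun l => setInd (update F i (insert y (F i)) l))) := by
  have hne : ∀ k : Fin (n + 1), swap (0 : Fin (n + 2)) i k.succ ≠ i := by
    intro k h
    have h2 := congrArg (swap (0 : Fin (n + 2)) i) h
    rw [swap_apply_self, swap_apply_right] at h2
    exact Fin.succ_ne_zero k h2
  have hj0' : swap (0 : Fin (n + 2)) i j ≠ 0 := by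
    intro h
    have h2 := congrArg (swap (0 : Fin (n + 2)) i) h
    rw [swap_apply_self, swap_apply_left] at h2
    exact hij h2.symm
  obtain ⟨k₀, hk₀⟩ := Fin.exists_succ_eq.2 hj0'
  have htailUp : ∀ k : Fin (n + 1), IsUpperSet (F (swap 0 i k.succ) : Set (Set ι)) := fun k => hF _
  have hyk : y ∉ F (swap 0 i k₀.succ) := by rw [hk₀, swap_apply_self]; exact hyj
  have key := combPos_sahiE_cons_sub_insert (F i) (fun k => F (swap 0 i k.succ)) hyi k₀ hyk
    (fun A hA => combPos_cycleSum_subfamily (n := n + 1) hM (fun k => F (swap 0 i k.succ)) htailUp A ⟨k₀, hA⟩)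
  refine key.congr fun p => ?_
  rw [← sahiE_comp_perm (bernoulliWeight p) (n + 2) (swap 0 i) (fun l => setInd (F l)),
    ← sahiE_comp_perm (bernoulliWeight p) (n + 2) (swap 0 i) (fun l => setInd (update F i (insert y (F i)) l)),
    SahiAbsorbed.comp_swap_eq_cons (fun l => setInd (update F i (insert y (F i)) l)) i,
    SahiAbsorbed.comp_swap_eq_cons (fun l => setInd (F l)) i]
  have htail : (fun k : Fin (n + 1) => setInd (update F i (insert y (F i)) (swap 0 i k.succ))) =
      fun k => setInd (F (swap 0 i k.succ)) := by
    funext k; rw [update_of_ne (hne k)]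
  rw [update_self, htail]

/-! ### (M⁺-(n+2)) is decided on coloured antichains -/

/-- **COMB POSITIVITY OF `E_{n+2}` IS DECIDED ON `(n+2)`-COLOURED ANTICHAINS.**  Let (M⁺-k) hold on the finite ground set `ι` for
`1 ≤ k ≤ n+1` (comb positivity of `p ↦ E_k(μ_p; 1_V)` for every `k` increasing families `V_j ⊆ 2^ι`).  If `p ↦ E_{n+2}(μ_p; 1_{U_0}, …, 1_{U_{n+1}})`
is comb-positive for every family `U_i = {S | ∀ T ∈ N, c T = i → ¬ S ⊆ T}` co-generated by an antichain `N ⊆ 2^ι` with a colouring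
`c : 2^ι → Fin (n+2)`, then it is comb-positive for EVERY family of `n+2` increasing families of `2^ι`: (M⁺-(n+2)) on `ι`.  (Saturation in the
comb order `G ≼ H :⟺ H − G comb-positive`, realised as inclusion of the sets `{G | E(F) − G comb-positive}`; the step is
`combPos_sahiE_sub_update_insert`.) [this work] -/
theorem combPos_sahiE_of_colouring {n : ℕ}
    (hM : ∀ k, 1 ≤ k → k ≤ n + 1 → ∀ V : Fin k → Set (Set ι), (∀ j, IsUpperSet (V j)) →
      CombPos (fun _ : ι => k) (fun p => sahiE (bernoulliWeight p) k (fun j => ind (V j))))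
    (h : ∀ (N : Finset (Set ι)) (c : Set ι → Fin (n + 2)), IsAntichain (· ≤ ·) (N : Set (Set ι)) →
      CombPos (fun _ : ι => n + 2) (fun p => sahiE (bernoulliWeight p) (n + 2)
        (fun i => ind {S | ∀ T ∈ N, c T = i → ¬ S ⊆ T})))
    (U : Fin (n + 2) → Set (Set ι)) (hU : ∀ j, IsUpperSet (U j)) :
    CombPos (fun _ : ι => n + 2) (fun p => sahiE (bernoulliWeight p) (n + 2) (fun j => ind (U j))) := by
  -- finset indicators versus set indicators
  have hconv : ∀ W : Finset (Set ι), setInd W = ind (W : Set (Set ι)) := by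
    intro W; funext ω
    by_cases hω : ω ∈ W
    · rw [setInd_apply, if_pos hω, ind_of_mem (mem_coe.2 hω)]
    · rw [setInd_apply, if_neg hω, ind_of_not_mem fun h' => hω (mem_coe.1 h')]
  -- (M⁺-k), k ≤ n+1, for finset families
  have hM' : ∀ k, 1 ≤ k → k ≤ n + 1 → ∀ V : Fin k → Finset (Set ι), (∀ j, IsUpperSet (V j : Set (Set ι))) →
      CombPos (fun _ : ι => k) (fun p => sahiE (bernoulliWeight p) k (fun j => setInd (V j))) := by
    intro k hk1 hkn V hV
    refine (hM k hk1 hkn (fun j => (V j : Set (Set ι))) hV).congr fun p => ?_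
    simp only [hconv]
  -- the comb-order functional: families ↦ the functions comb-dominated by `E(F)`
  let E : (Fin (n + 2) → Finset (Set ι)) → (ι → unitInterval) → ℝ :=
    fun F p => sahiE (bernoulliWeight p) (n + 2) (fun j => setInd (F j))
  let Ψ : (Fin (n + 2) → Finset (Set ι)) → Set ((ι → unitInterval) → ℝ) :=
    fun F => {G | CombPos (fun _ : ι => n + 2) (fun p => E F p - G p)}
  have hstep : ∀ W : Fin (n + 2) → Finset (Set ι), (∀ j, IsUpperSet (W j : Set (Set ι))) →
      ∀ i j, i ≠ j → ∀ y, y ∉ W i → (∀ z, y < z → z ∈ W i) → y ∉ W j → Ψ (update W i (insert y (W i))) ≤ Ψ W := by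
    intro W hW i j hij y hyi _ hyj G hG
    have hG' : CombPos (fun _ : ι => n + 2) (fun p => E (update W i (insert y (W i))) p - G p) := hG
    show CombPos (fun _ : ι => n + 2) (fun p => E W p - G p)
    exact ((combPos_sahiE_sub_update_insert hM' W hW i j hij y hyi hyj).add hG').congr fun p => by
      simp only [E]; ring
  have hcol : ∀ (N : Finset (Set ι)) (c : Set ι → Fin (n + 2)), IsAntichain (· ≤ ·) (N : Set (Set ι)) →
      {G : (ι → unitInterval) → ℝ | CombPos (fun _ : ι => n + 2) (fun p => - G p)} ≤
        Ψ (fun i => univ.filter fun q : Set ι => ∀ p ∈ N, c p = i → ¬ q ≤ p) := by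
    intro N c hN G hG
    have hG' : CombPos (fun _ : ι => n + 2) (fun p => - G p) := hG
    have hmem : (fun i => setInd (univ.filter fun q : Set ι => ∀ p ∈ N, c p = i → ¬ q ≤ p)) =
        fun i => ind {S | ∀ T ∈ N, c T = i → ¬ S ⊆ T} := by
      funext i; rw [hconv]; congr 1; ext S; simp
    show CombPos (fun _ : ι => n + 2) (fun p => E _ p - G p)
    exact ((h N c hN).add hG').congr fun p => by simp only [E, hmem]; ring
  let F : Fin (n + 2) → Finset (Set ι) := fun j => univ.filter (· ∈ U j)
  have hcoe : ∀ j, (↑(F j) : Set (Set ι)) = U j := by intro j; ext S; simp [F]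
  have hFup : ∀ j, IsUpperSet (F j : Set (Set ι)) := fun j => by rw [hcoe]; exact hU j
  have key : {G : (ι → unitInterval) → ℝ | CombPos (fun _ : ι => n + 2) (fun p => - G p)} ≤ Ψ F :=
    Saturation.le_of_colouring Ψ hstep hcol F hFup
  have h0 : (fun _ : ι → unitInterval => (0 : ℝ)) ∈ Ψ F := by
    refine key ?_
    show CombPos (fun _ : ι => n + 2) (fun _ => - (0 : ℝ))
    simpa using CombPos.zero (fun _ : ι => n + 2)
  have h0' : CombPos (fun _ : ι => n + 2) (fun p => E F p - 0) := h0
  refine h0'.congr fun p => ?_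
  simp only [E, sub_zero]
  congr 1
  funext j
  rw [hconv, hcoe]

/-- The same with the hypothesis (M⁺-k), `k ≤ n+1`, supplied by the GLOBAL conjecture-shaped statements `MasterFamilyCombPos k` restricted to
nothing — convenient when the lower orders are theorems for every ground set (`masterFamilyCombPos_one/two`). [this work] -/
theorem combPos_sahiE_of_colouring' {n : ℕ} (hM : ∀ k, 1 ≤ k → k ≤ n + 1 → MasterFamilyCombPos k)
    (h : ∀ (N : Finset (Set ι)) (c : Set ι → Fin (n + 2)), IsAntichain (· ≤ ·) (N : Set (Set ι)) →
      CombPos (fun _ : ι => n + 2) (fun p => sahiE (bernoulliWeight p) (n + 2)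
        (fun i => ind {S | ∀ T ∈ N, c T = i → ¬ S ⊆ T})))
    (U : Fin (n + 2) → Set (Set ι)) (hU : ∀ j, IsUpperSet (U j)) :
    CombPos (fun _ : ι => n + 2) (fun p => sahiE (bernoulliWeight p) (n + 2) (fun j => ind (U j))) :=
  combPos_sahiE_of_colouring (fun k hk1 hkn V hV => hM k hk1 hkn ι V hV) h U hU

end SahiComb

end Summit.CriticalPhenomena.PercolationContinuityZ3.Theorems
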